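import Summits.BirchSwinnertonDyer.BirchSwinnertonDyer.Theorems.TwinTransportX9RungInstance

/-!
# Route `TwinTransportX9` — the AUXILIARY-FIELD (first-disjunct) RUNG SCHEMA of the deciding crux `TrivialTwinSupplyX9` (item 24080)

The two landed schemata of the crux body at `(W, p)` both certify `p ∤ #Ш` of the deciding twin through a Heegner point
over the frame's OWN field: `rung_of_frame` (first disjunct) uses `y_{K₀} ∈ W(K₀)`, `K₀ = ℚ(√d_K)`, and transports
`Ш(W/K₀)[p] = 0` to `W₁ ≅ W^{(d_K)}`; `rung_of_two_frames` (second disjunct) uses `y_{K₁} ∈ W₁(K₁)` for the inner frame.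
Either way the curve carrying the Heegner point must have analytic rank `1` over `ℚ` up to the twist, so BY PARITY both
schemata only reach pairs with `r_an(W) ≤ 2`: for `w(W) = -1` and `r_an(W) ≥ 3` (the X9 table's first such pair is
`133956a1` at `p = 5`, `r_an = 3`) the `K₀`-Heegner point of `W` is torsion (`r_an(W/K₀) = r_an(W) + r_an(W^{(d_K)}) ≥ 3`),
and `W₁ ≅ W^{(d_K)}` has EVEN analytic rank, so it carries no Heegner point of its own frames either.

**This file removes that restriction for the first disjunct.** `rung_of_frame_aux` certifies `p ∤ #Ш(W₁)` through an
AUXILIARY imaginary quadratic field `K₁` of the twin `W₁` itself — ANY `K₁ ≠ ℚ(√-3), ℚ(√-1)` satisfying the Heegner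
hypothesis for a level `N₁` with the named facts `kolyvagin N₁ W₁ K₁` (Kolyvagin 1990 Thm. A) and Matar–Nekovář 2019
Thm. 0.3 for `(N₁, W₁, K₁)`, and a Heegner point `y ∈ W₁(K₁)` of infinite order with `p ∤ [W₁(K₁) : ℤy]` — with NO
admissibility asked of `K₁` (the crux asks admissibility of the OUTER frame only; `K₁` is a device for `Ш(W₁)`, exactly
Gross 1991 Prop. 2.1/2.3 for `W₁` directly, without the twist transport of rung #1 §3). When `r_an(W₁) = 0` such a `K₁`
exists in abundance (Bump–Friedberg–Hoffstein / Murty–Murty: infinitely many `d` with `r_an(W₁^{(d)}) = 1`), and the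
index `[W₁(K₁) : ℤy]` is computable from a generator of the RANK-ONE twist `W₁^{(disc K₁)}(ℚ)` and Gross–Zagier — which
is what the preregistered engine of the seat that landed this file certifies (memo `Cruxes/TrivialTwinSupplyX9/Lines/
PREREG-rank3aux-v1.md`). The `ClassX9`/Tamagawa transport along the outer frame is CITED from the two-step schema
(`classX9_and_not_dvd_tamagawaProduct_of_frame`), not restated.

HONEST FRAMING: a REDUCTION, uniform in all displayed data; it proves neither the crux `TrivialTwinSupplyX9` (the SUPPLY
of an admissible frame with a certified trivial twin for EVERY X9 pair is a named open problem: Prasanna 2010 p. 400)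
nor BSD; an instance obtained from it is ONE decided instance `CruxInstance W p` (a T3 witness), never distance to the
summit.

References: Matar–Nekovář 2019 Thm. 0.3 [MatarNekovar2019]; Kolyvagin 1990 Thm. A [KolyvaginEulerSystems1990];
Gross 1991 §2 Prop. 2.1 (2), Prop. 2.3 [GrossLMS1991]; Gross–Zagier 1986 Thm. I.6.3 [GrossZagier1986]; Jetchev–Skinner–Wan
2017 §7.3.1 (eq:tamK) [JetchevSkinnerWan2017]; Burungale–Castella–Skinner 2025 §1.2, Prop. 5.2.1
[BurungaleCastellaSkinner2025]; Bump–Friedberg–Hoffstein 1990 Thm. 1 [BumpFriedbergHoffstein1990]; Murty–Murty 1991 Thm. 1 [MurtyMurty1991]; Prasanna 2010 p. 400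
[Prasanna2010CJM]; Serre, *Galois Cohomology* I.§2.4 [SerreGaloisCohomology1997].
-/

set_option linter.dupNamespace false
set_option autoImplicit false

noncomputable section

open scoped Classical NumberField

open WeierstrassCurve Literature.NumberTheory.EllipticCurves
  Literature.NumberTheory.EllipticCurves.Rank1Residual.X11RankOneCertificates
  Summit.BirchSwinnertonDyer.Rank1Residual.X11b
  Summit.BirchSwinnertonDyer.BirchSwinnertonDyer.Rank1Residual.IntModel
  Summit.BirchSwinnertonDyer.BirchSwinnertonDyer.Rank1Residual
  Summit.BirchSwinnertonDyer.BirchSwinnertonDyer.Theses.TwinTransportX9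

namespace Summit.BirchSwinnertonDyer.BirchSwinnertonDyer.Theorems.TwinTransportX9Rung

/-! ## §1 `Ш(E/ℚ)[p] = 0` from a Heegner point of `E` itself of index prime to `p` (irreducible image; no twist) -/

section Direct

variable {K : Type} [Field K] [NumberField K]

/-- **`Ш(E/ℚ)` is finite of order prime to `p` from a Heegner point of index prime to `p`, IRREDUCIBLE image — the
UNTWISTED form of rung #1 §3.** For `E/ℚ` (model `V`), `K` imaginary quadratic with `disc K ≠ -3, -4` satisfying the
Heegner hypothesis for `N`, `P ∈ E(K)` a Heegner point of infinite order with `p ∤ [E(K) : ℤP]`, `p` odd and `ρ̄_{E,p}`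
irreducible: Kolyvagin (`kolyvagin N V K`, Thm. A) gives `Ш(E/K)` finite, Matar–Nekovář Thm. 0.3 gives `p ∤ #Ш(E/K)`,
hence `Ш(E/ℚ)` is finite (restriction has finite kernel) and, restriction `Ш(E/ℚ) → Ш(E/K)` being injective on
`p`-torsion for `p ∤ [K:ℚ] = 2`, `Ш(E/ℚ)[p] = 0`, i.e. `p ∤ #Ш(E/ℚ)` — Gross 1991 Prop. 2.1 (2) / 2.3 verbatim.
[cite: GrossLMS1991, §2 Prop. 2.1 (2) and Prop. 2.3] [cite: MatarNekovar2019, Thm. 0.3 (p. 456)]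
[cite: KolyvaginEulerSystems1990, Thm. A] [cite: SerreGaloisCohomology1997, I.§2.4 Cor. to Prop. 9] -/
theorem shaFinite_and_not_dvd_shaOrder_of_mn03 {N : ℕ} [NeZero N] (V : WeierstrassCurve ℚ) [V.IsElliptic]
    (hK : IsImaginaryQuadratic K) {d : ℤ} (hdK : NumberField.discr K = d) (hD3 : d ≠ -3) (hD4 : d ≠ -4)
    (hH : SatisfiesHeegnerHypothesis N K) (hKo : kolyvagin N V K)
    (hMN : MatarNekovar2019.thm03_padicValNat_card_sha_le_of_irreducible N V K)
    {P : (V.baseChange K).toAffine.Point} (hP : IsHeegnerPoint N V K P) (hnt : ¬ IsOfFinAddOrder P)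
    {p : ℕ} [Fact p.Prime] (hp2 : p ≠ 2) (hirr : V.HasIrreducibleModPGaloisRep p)
    (hI : ¬ p ∣ (AddSubgroup.zmultiples P).index) :
    V.ShaFinite ∧ ¬ p ∣ V.shaOrder := by
  have hp : p.Prime := Fact.out
  obtain ⟨-, hfinK⟩ := hKo hK hH hP hnt
  have h0 : padicValNat p (Nat.card (V.baseChange K).sha) = 0 :=
    MatarNekovar2019.padicValNat_card_sha_eq_zero_of_not_dvd_index_of_irreducible hMN hK hH
      (by rw [hdK]; exact hD3) (by rw [hdK]; exact hD4) hP hnt hp hp2 hirr hI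
  haveI hfin : Finite (V.baseChange K).sha := hfinK
  have hndvd : ¬ p ∣ Nat.card (V.baseChange K).sha := by
    rcases padicValNat.eq_zero_iff.mp h0 with h1 | h0' | hnd
    · exact absurd h1 hp.one_lt.ne'
    · exact absurd h0' Nat.card_pos.ne'
    · exact hnd
  haveI : IsGalois ℚ K := by
    haveI : Algebra.IsQuadraticExtension ℚ K := ⟨hK.1⟩
    infer_instance
  have hcop : p.Coprime (Module.finrank ℚ K) := by
    rw [hK.1]
    exact (Nat.coprime_primes hp Nat.prime_two).mpr hp2
  have hnoP : ∀ x : V.sha, (p : ℤ) • x = 0 → x = 0 := by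
    intro x hx
    have hxn : p • x = 0 := by rw [← natCast_zsmul]; exact hx
    have hres : shaRestriction V K x = 0 := by
      have hpr : p • shaRestriction V K x = 0 := by rw [← map_nsmul, hxn, map_zero]
      have hdiv : addOrderOf (shaRestriction V K x) ∣ p := addOrderOf_dvd_of_nsmul_eq_zero hpr
      rcases (Nat.dvd_prime hp).mp hdiv with h1 | hp'
      · exact AddMonoid.addOrderOf_eq_one_iff.mp h1
      · exact absurd (hp' ▸ addOrderOf_dvd_natCard (shaRestriction V K x)) hndvd
    have hx_mem : x ∈ (AddSubgroup.torsionBy V.sha p : Set V.sha) :=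
      AddSubgroup.torsionBy.nsmul_iff.mpr hxn
    have h0_mem : (0 : V.sha) ∈ (AddSubgroup.torsionBy V.sha p : Set V.sha) :=
      AddSubgroup.torsionBy.nsmul_iff.mpr (smul_zero _)
    exact injOn_shaRestriction_torsionBy V K hcop hx_mem h0_mem (by rw [hres, map_zero])
  have hfinQ : V.ShaFinite := shaFinite_of_baseChange V K hfin
  refine ⟨hfinQ, ?_⟩
  have hv := Rank1Residual.Typed.padicValNat_shaOrder_eq_zero_of_noPTorsion V p hfinQ hnoP
  rcases padicValNat.eq_zero_iff.mp hv with h1 | h0' | hnd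
  · exact absurd h1 hp.one_lt.ne'
  · exact absurd h0' (shaOrder_pos V hfinQ).ne'
  · exact hnd

end Direct

/-! ## §2 The auxiliary-field rung schema (first disjunct, class-wide reduction) -/

/-- **THE AUXILIARY-FIELD RUNG SCHEMA.** For ANY globally minimal elliptic `W/ℚ`, prime `p`, BCS-admissible OUTER frame
`(d_K, d_F)` at `(W, p)` with a quadratic field `K₀` of discriminant `d_K` (used only to move `ClassX9` and `ord_p ∏ c_ℓ`
along the frame, Jetchev–Skinner–Wan (eq:tamK)); ANY globally minimal `W₁` with `C₀ • W₁ = W^{(d_K)}`, `r_an(W₁) = 0`,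
`L(W₁,1)/Ω(W₁) = q₀` with `ord_p q₀ = 0` (S1); and ANY AUXILIARY imaginary quadratic `K₁`, `disc K₁ = d₁ ≠ -3, -4`, with
the Heegner hypothesis for a level `N₁`, the named facts `kolyvagin N₁ W₁ K₁` and Matar–Nekovář Thm. 0.3 for
`(N₁, W₁, K₁)`, and a Heegner point `y ∈ W₁(K₁)` of infinite order with `p ∤ [W₁(K₁) : ℤy]` (S2 for the twin itself):
the crux body of `TrivialTwinSupplyX9` holds at `(W, p)` — FIRST disjunct, witnessed by `(d_K, d_F)` and `W₁`.
Proof: `ClassX9 W₁ p` and `p ∤ ∏ c_ℓ(W₁)` by `classX9_and_not_dvd_tamagawaProduct_of_frame`; `p ∤ #Ш(W₁)` by §1 applied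
to `W₁` over `K₁` (`ρ̄_{W₁,p}` irreducible is part of `ClassX9 W₁ p`; `p ≥ 5` is odd); `p ∤ #W₁(ℚ)_tors` from
irreducibility. NO admissibility is asked of `K₁`. HONEST FRAMING: a REDUCTION, uniform in
`(W, p, d_K, d_F, K₀, W₁, C₀, q₀, K₁, d₁, N₁, y)`; it proves neither the crux (Prasanna 2010 p. 400: the supply is open)
nor BSD; it is the kernel through which X9 pairs of analytic rank ≥ 3 (first: `133956a1`, `p = 5`) can be decided at all.
[cite: MatarNekovar2019, Thm. 0.3 (p. 456)] [cite: KolyvaginEulerSystems1990, Thm. A]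
[cite: GrossLMS1991, §2 Prop. 2.1 (2), Prop. 2.3] [cite: JetchevSkinnerWan2017, §7.3.1 (eq:tamK)]
[cite: BurungaleCastellaSkinner2025, §1.2, Prop. 5.2.1] [cite: Prasanna2010CJM, p. 400 (Introduction)] -/
theorem rung_of_frame_aux (W : WeierstrassCurve ℚ) [W.IsElliptic] [W.IsGloballyMinimal] {p : ℕ} [Fact p.Prime]
    {dK₀ dF₀ : ℤ} (hadm₀ : BCSAdmissiblePair W p dK₀ dF₀)
    {K₀ : Type} [Field K₀] [NumberField K₀] (hK₀ : Module.finrank ℚ K₀ = 2) (hdK₀ : NumberField.discr K₀ = dK₀)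
    (V₁ : WeierstrassCurve ℚ) [V₁.IsElliptic] [V₁.IsGloballyMinimal] {C₀ : VariableChange ℚ}
    (hC₀ : C₀ • V₁ = W.quadraticTwist (dK₀ : ℚ))
    {K₁ : Type} [Field K₁] [NumberField K₁] (hK₁ : IsImaginaryQuadratic K₁) {d₁ : ℤ}
    (hdK₁ : NumberField.discr K₁ = d₁) (hD3 : d₁ ≠ -3) (hD4 : d₁ ≠ -4)
    {N₁ : ℕ} [NeZero N₁] (hH : SatisfiesHeegnerHypothesis N₁ K₁) (hKo : kolyvagin N₁ V₁ K₁)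
    (hMN : MatarNekovar2019.thm03_padicValNat_card_sha_le_of_irreducible N₁ V₁ K₁)
    {P : (V₁.baseChange K₁).toAffine.Point} (hP : IsHeegnerPoint N₁ V₁ K₁ P) (hnt : ¬ IsOfFinAddOrder P)
    (hI : ¬ p ∣ (AddSubgroup.zmultiples P).index)
    (hr₁ : V₁.analyticRank = 0) {q₀ : ℚ}
    (hL₁ : V₁.leadingLCoeff / (V₁.realPeriodRat : ℂ) = (q₀ : ℂ)) (hq : padicValRat p q₀ = 0) :
    ClassX9 W p → ¬ p ∣ W.tamagawaProduct → ∃ dK dF : ℤ, BCSAdmissiblePair W p dK dF ∧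
      ∃ (W₁ : WeierstrassCurve ℚ) (_ : W₁.IsElliptic) (_ : W₁.IsGloballyMinimal),
        (∃ C : WeierstrassCurve.VariableChange ℚ, C • W₁ = W.quadraticTwist (dK : ℚ)) ∧
        ((W₁.analyticRank = 0 ∧ ¬ p ∣ W₁.shaOrder ∧ ¬ p ∣ W₁.tamagawaProduct ∧ ¬ p ∣ W₁.torsionOrder ∧
            ∃ q : ℚ, W₁.leadingLCoeff / (W₁.realPeriodRat : ℂ) = (q : ℂ) ∧ padicValRat p q = 0) ∨
          ∃ dK' dF' : ℤ, BCSAdmissiblePair W₁ p dK' dF' ∧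
            ∃ (W₂ : WeierstrassCurve ℚ) (_ : W₂.IsElliptic) (_ : W₂.IsGloballyMinimal),
              (∃ C : WeierstrassCurve.VariableChange ℚ, C • W₂ = W₁.quadraticTwist (dK' : ℚ)) ∧
              (W₂.analyticRank = 0 ∧ ¬ p ∣ W₂.shaOrder ∧ ¬ p ∣ W₂.tamagawaProduct ∧ ¬ p ∣ W₂.torsionOrder ∧
                ∃ q : ℚ, W₂.leadingLCoeff / (W₂.realPeriodRat : ℂ) = (q : ℂ) ∧ padicValRat p q = 0)) := by
  intro hX9 hTam
  have hp : p.Prime := Fact.out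
  have hp5 : 5 ≤ p := hX9.2.1
  have hp2 : p ≠ 2 := by omega
  obtain ⟨hX9₁, hTam₁⟩ := classX9_and_not_dvd_tamagawaProduct_of_frame W hadm₀ hK₀ hdK₀ V₁ hC₀ hX9 hTam
  have hirr₁ : V₁.HasIrreducibleModPGaloisRep p := hX9₁.2.2.2.2.1
  -- `Ш(W₁)`: Kolyvagin + Matar–Nekovář over the AUXILIARY field `K₁` of `W₁` itself (no transport)
  have hsha : ¬ p ∣ V₁.shaOrder :=
    (shaFinite_and_not_dvd_shaOrder_of_mn03 V₁ hK₁ hdK₁ hD3 hD4 hH hKo hMN hP hnt hp2 hirr₁ hI).2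
  -- `#W₁(ℚ)_tors`: irreducibility of `ρ̄_{W₁,p}`
  have htors : ¬ p ∣ V₁.torsionOrder :=
    not_dvd_of_padicValNat_eq_zero hp V₁.torsionOrder_pos_holds
      (Rank1Residual.padicValNat_torsionOrder_eq_zero_of_irreducible V₁ p hirr₁)
  exact ⟨dK₀, dF₀, hadm₀, V₁, ‹_›, ‹_›, ⟨C₀, hC₀⟩, Or.inl ⟨hr₁, hsha, hTam₁, htors, q₀, hL₁, hq⟩⟩

/-- **The auxiliary-field schema IS a schema of instances of the crux**: its conclusion at `(W, p)` is `CruxInstance W p`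
verbatim (nothing is claimed about the crux in general; BSD is not proved). [cite: BurungaleCastellaSkinner2025, §1.2 and Prop. 5.2.1] -/
theorem cruxInstance_of_frame_aux (W : WeierstrassCurve ℚ) [W.IsElliptic] [W.IsGloballyMinimal] {p : ℕ} [Fact p.Prime]
    {dK₀ dF₀ : ℤ} (hadm₀ : BCSAdmissiblePair W p dK₀ dF₀)
    {K₀ : Type} [Field K₀] [NumberField K₀] (hK₀ : Module.finrank ℚ K₀ = 2) (hdK₀ : NumberField.discr K₀ = dK₀)
    (V₁ : WeierstrassCurve ℚ) [V₁.IsElliptic] [V₁.IsGloballyMinimal] {C₀ : VariableChange ℚ}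
    (hC₀ : C₀ • V₁ = W.quadraticTwist (dK₀ : ℚ))
    {K₁ : Type} [Field K₁] [NumberField K₁] (hK₁ : IsImaginaryQuadratic K₁) {d₁ : ℤ}
    (hdK₁ : NumberField.discr K₁ = d₁) (hD3 : d₁ ≠ -3) (hD4 : d₁ ≠ -4)
    {N₁ : ℕ} [NeZero N₁] (hH : SatisfiesHeegnerHypothesis N₁ K₁) (hKo : kolyvagin N₁ V₁ K₁)
    (hMN : MatarNekovar2019.thm03_padicValNat_card_sha_le_of_irreducible N₁ V₁ K₁)
    {P : (V₁.baseChange K₁).toAffine.Point} (hP : IsHeegnerPoint N₁ V₁ K₁ P) (hnt : ¬ IsOfFinAddOrder P)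
    (hI : ¬ p ∣ (AddSubgroup.zmultiples P).index)
    (hr₁ : V₁.analyticRank = 0) {q₀ : ℚ}
    (hL₁ : V₁.leadingLCoeff / (V₁.realPeriodRat : ℂ) = (q₀ : ℂ)) (hq : padicValRat p q₀ = 0) :
    CruxInstance W p :=
  rung_of_frame_aux W hadm₀ hK₀ hdK₀ V₁ hC₀ hK₁ hdK₁ hD3 hD4 hH hKo hMN hP hnt hI hr₁ hL₁ hq

end Summit.BirchSwinnertonDyer.BirchSwinnertonDyer.Theorems.TwinTransportX9Rung

end
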